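/-
Copyright (c) 2026 the pub-hodgecm-mathlib formalisation cell (harness21).  Prover seat hodgecm-mathlib-K2E3-p20 (g3), Track B «K2-LIT» ∕ h413,
line `K2_E3_EllipticInputs`, unit U12 «Characters», socket #11 `sig_K2E3CharLocIntNearSemisimple`, road (11-SC) «by class», letter (SC-an)
`sig_K2E3SupercuspidalTruncatedCharAnalytic` — its DOMINATION half (SC-dom) as a sorry-free COMPOSITION of the analytic bricks (D1)–(D4) of Harish-Chandra's
Theorem 16.  Deal K2E3-plan (g2) 2026-09-04T01:04:01Z «(D5)-FIRST GO»; census `K2/K2E3-p20/g3/CENSUS-SCdom.K2E3-p20-g3.md` f81da062.  2026-09-04.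
-/
import Summits.HodgeConjecture.HodgeConjecture.Theorems.K2E3CharLocIntNearSemisimpleSupercuspidalOfTruncated   -- ★ p856184 (this seat): §1 frame facts (compact centre, nonarchimedean, …); brings ★ p856087 (properness on the elliptic set), ★ p856074
import Mathlib.MeasureTheory.Integral.Bochner.Set
import HarnessLib

/-!
# K2_E3 road (h413 = stmt-HodgeConjecture-24833), unit U12 «Characters», socket #11, road (11-SC), letter (SC-an) — THE DOMINATION HALF (SC-dom) FROM BRICKS:
# «localisation of the truncated orbital integrand to a compact ball» (Thm 20) ⊕ «ball bound by a weight `W`» (Thms 14, 18, 19) ⊕ «`W ∈ L¹_loc`» (Thm 15)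
# ⇒ `∃ M ∈ L¹_loc, ‖Θₙ(g)‖ ≤ M(g)` a.e., every `n` (Harish-Chandra 1970, Part VII §3 pp. 71–73)

Cell `pub/hodgecm-mathlib` (D-0151), Track B (21-frontier RULING «PUSH BOTH» 2026-09-03), socket module
`Summits/HodgeConjecture/HodgeConjecture/Cruxes/H413/Lines/K2_E3_EllipticInputsSigs_U12Characters.lean`, letter **(SC-an)** `sig_K2E3SupercuspidalTruncatedCharAnalytic`
(cand `K2/K2E3-p20/g3/…cand…` 3fdea465fc557179, K2E3-r02 BOX PASS 2026-09-04T00:52Z; to be hosted in U12 ED. 6), whose consumer is ★ p856184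
`charLocIntNearSemisimple_supercuspidal_of_exists_truncated`.  `--supports stmt-HodgeConjecture-24833 --as helper`; THEOREMS ONLY — no `def`, no named fact, no
instance, no notation, no `sorry`.  Deal: K2E3-plan (g2) 01:04:01Z «(D5)-FIRST GO … freezes the four heads».

THE MATHEMATICS = the domination step of the proof of [HarishChandra1970, Thm 16], pp. 71–73, with its analytic inputs as HYPOTHESES.  For `θ` a supercusp form
(here ANY continuous `θ`), `Θₙ(g) = ∫_{Ω n} θ(x g x⁻¹) dμ(x)`:
* (D3′) LOCALISATION TO A COMPACT BALL, UNIFORM IN `n` [Thm 20 p. 70 + the Corollary of Thm 18, eq. (1) p. 71]: for `γ` regular NON-elliptic (and `g = γ^{y₀}` with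
  `1 + σ(y₀) ≤ c₀(1+|λ(γ)|)`), the `K₁`-average `x ↦ ∫_{K₁} θ(γ^{x k y₀}) dk` vanishes unless `x ∈ Ω(γ) = {1 + σ(x) ≤ c₁(1+|λ(γ)|)²}` — so, `Ω_T` and `Ω(γ)` being
  right-`K₁`-invariant, `∫_{Ω_T} θ(x g x⁻¹) dx = ∫_{Ω_T ∩ Ω(γ)} θ(x g x⁻¹) dx` for EVERY `T`; here: a family of COMPACT sets `Bset g` with
  `hcanc : ∀ n, ∀ᵐ g, ¬EllReg g → ∫_{Ω n} θ(xgx⁻¹) = ∫_{Ω n ∩ Bset g} θ(xgx⁻¹)`.  On the regular ELLIPTIC set (`EllReg g` :≡ regular with compact centraliser) the same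
  localisation is ELEMENTARY — the integrand vanishes off the compact `{x : x g x⁻¹ ∈ supp θ}` (★ p856087 ∕ ★ p856055 properness) — and is discharged inside (§2).
* (D1–2′) BALL BOUND [Thm 14 p. 60 «`sup_{a ∈ ω_A′} |D(a)|^{1∕2} ∫_{G∕A} |h(a^x)| dx* < ∞`» + Thms 18–19 p. 69 (`∫_{A} Φ_γ ≤ c₃(1+|λ(γ)|)^{4ℓ}`), p. 72]:
  `hball : ∀ᵐ g, ¬EllReg g → ∫_{Bset g} ‖θ(xgx⁻¹)‖ ≤ W g` and, on the elliptic set where the ball is all of `G` (`ℓ = 0`), `hballE : ∀ᵐ g, EllReg g → ∫_G ‖θ(xgx⁻¹)‖ ≤ W g`,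
  for a weight `W : G → ℝ` (print: `c₅ |D|^{−1∕2}(1+|λ|)^{4ℓ}`, the constant depending on a compact `ω` — piecewise on a countable compact partition of `G`).
* (D4′) `hW : LocallyIntegrable W μ` [Thm 15 p. 63 «`|D|^{−1∕2−ε}` is locally summable» + `(1+|log_q|D||)^{4ℓ} ≤ C_ε|D|^{−ε}`; at `N = 3` the ★ road HC-D].
THEN **(SC-dom)**: `∃ M (:= W), LocallyIntegrable M μ ∧ ∀ n, ∀ᵐ g, ‖Θₙ g‖ ≤ M g` — because `‖∫_{Ω n ∩ Bset g} θ(xgx⁻¹)‖ ≤ ∫_{Bset g} ‖θ(xgx⁻¹)‖` (`θ` continuous, the ball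
compact, the measure finite on compacta).  `W` and `Bset` are BINDERS: the analytic bricks (D1)–(D4) state them in their own `|D_G|`∕height currency.

* §1 GENERIC (any topological group with a Borel measure finite on compacta, any continuous `θ`, any `Ω : ℕ → Set G`): `norm_setIntegral_conj_le_of_localisation`,
  **`truncated_dominated_of_bricks`** (with an abstract exceptional predicate `E` in place of `EllReg`).
* §2 AT THE SOCKET'S DATA (`G = (cmDatum L N H).Local v`, `v` non-split, `θ = B v₁ (r.ρ · v₁)` for a supercuspidal `r`, `Ω : CompactExhaustion G`): the elliptic
  localisation discharged (★ `isCompact_setOf_conj_mem_cmDatum_local`), **`truncatedCharDominated_of_bricks`** = EXACTLY the 2nd ∧ 3rd conjuncts of (SC-an).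
* §3 **`sigSCan_datum_of_bricks`** — adding the limit brick `(F, hlim∖ell)` gives the whole (SC-an) ∃-statement `∃ Ω F M, (SC-lim∖ell) ∧ (SC-dom) ∧ M ∈ L¹_loc` for the datum
  (the form hosted in U12 and consumed by ★ p856184 (C)).

HONEST LABEL: HC_CM is proved only modulo the 7 printed citations (2 remaining named inputs: hLiu418 = stmt-HodgeConjecture-24832, h413 =
stmt-HodgeConjecture-24833) until rung 0 closes; count-neutral `--supports` helper: row #11 and (SC-an) stay OPEN — this file only fixes the SHAPE in which the bricks
(D1)∕(D2)∕(D3)∕(D4) [HarishChandra1970 Thms 14, 18–19, 20, 15] will be consumed.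

## References
* [HarishChandra1970] Harish-Chandra (notes by G. van Dijk), *Harmonic Analysis on Reductive p-adic Groups*, LNM 162 (1970): Part VI §8 Thm 14 p. 60; Part VII §1 Thm 15
  p. 63; §2 Thms 18–20 pp. 69–70; §3 pp. 70–73 (proof of Thm 16: eq. (1) p. 71, the bound p. 72–73).
* [Rogawski1990] J. D. Rogawski, *Automorphic Representations of Unitary Groups in Three Variables*, Ann. of Math. Stud. 123 (1990), §12.2 p. 173 (compact centre).
-/

set_option autoImplicit false
-- the mandated namespace has the single-problem summit's repeated segment (`HodgeConjecture.HodgeConjecture`)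
set_option linter.dupNamespace false

noncomputable section

open MeasureTheory Topology Filter NumberField IsDedekindDomain
open scoped Matrix MatrixGroups
open Literature.NumberTheory.Automorphic Literature.NumberTheory.Automorphic.UnitaryGroup Literature.NumberTheory.Rogawski1990

namespace Summit.HodgeConjecture.HodgeConjecture.Cruxes.H413.K2E3SupercuspidalTruncatedCharDominationOfBricks

/-! ## §1 Generic: localisation to a compact ball ⊕ ball bound ⊕ integrable weight ⇒ domination -/

section Generic

variable {G : Type*} [Group G] [TopologicalSpace G] [IsTopologicalGroup G] [T2Space G] [MeasurableSpace G] [BorelSpace G]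

/-- **One truncation, one element**: if the truncated orbital integral over `S` of the continuous `θ` at `g` LOCALISES to the compact ball `T`
(`∫_S θ(xgx⁻¹) = ∫_{S ∩ T} θ(xgx⁻¹)`), then `‖∫_S θ(xgx⁻¹) dμ‖ ≤ ∫_T ‖θ(xgx⁻¹)‖ dμ` (the measure finite on compacta).  Print: «From (1) we get
`|Θ_T(γ^y)| ≤ ∫ Φ_γ(x y₀⁻¹) |θ(γ^x)| dx*`» [cite: HarishChandra1970, Part VII §3 p. 72]. -/
theorem norm_setIntegral_conj_le_of_localisation (μ : Measure G) [IsFiniteMeasureOnCompacts μ] {θ : G → ℂ} (hθ : Continuous θ)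
    (g : G) {S T : Set G} (hT : IsCompact T)
    (hloc : ∫ x in S, θ (x * g * x⁻¹) ∂μ = ∫ x in S ∩ T, θ (x * g * x⁻¹) ∂μ) :
    ‖∫ x in S, θ (x * g * x⁻¹) ∂μ‖ ≤ ∫ x in T, ‖θ (x * g * x⁻¹)‖ ∂μ := by
  rw [hloc]
  have hcont : Continuous fun x : G => θ (x * g * x⁻¹) := hθ.comp ((continuous_id.mul continuous_const).mul continuous_inv)
  have hint : IntegrableOn (fun x : G => ‖θ (x * g * x⁻¹)‖) T μ := (hcont.norm.continuousOn).integrableOn_compact hT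
  calc ‖∫ x in S ∩ T, θ (x * g * x⁻¹) ∂μ‖ ≤ ∫ x in S ∩ T, ‖θ (x * g * x⁻¹)‖ ∂μ := norm_integral_le_integral_norm _
    _ ≤ ∫ x in T, ‖θ (x * g * x⁻¹)‖ ∂μ :=
      setIntegral_mono_set hint (Eventually.of_forall fun x => norm_nonneg _) (Eventually.of_forall Set.inter_subset_right)

/-- **(SC-dom) FROM BRICKS, GENERIC FORM.**  Let `θ : G → ℂ` be continuous, `μ` finite on compacta, `Ω : ℕ → Set G` any truncation family, and `E` an «exceptional»
predicate (at the socket: regular with compact centraliser).  GIVEN (D3′) a family of COMPACT balls `Bset g` localising the truncated orbital integrals UNIFORMLY IN `n`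
off `E` (`hcanc`) and on `E` (`hcancE`, with the ball `BsetE g`), (D1–2′) ball bounds by a weight `W` off and on `E` (`hball`, `hballE`), and (D4′) `W ∈ L¹_loc(μ)`,
THEN `∃ M ∈ L¹_loc(μ), ∀ n, ‖∫_{Ω n} θ(xgx⁻¹) dμ‖ ≤ M g` for `μ`-a.e. `g` — with `M = W`.
[cite: HarishChandra1970, Part VII §3 pp. 71–73] -/
theorem truncated_dominated_of_bricks (μ : Measure G) [IsFiniteMeasureOnCompacts μ] {θ : G → ℂ} (hθ : Continuous θ)
    (Ω : ℕ → Set G) (E : G → Prop)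
    (BsetE : G → Set G) (hBsetEc : ∀ g, IsCompact (BsetE g))
    (hcancE : ∀ n, ∀ᵐ g ∂μ, E g → ∫ x in Ω n, θ (x * g * x⁻¹) ∂μ = ∫ x in Ω n ∩ BsetE g, θ (x * g * x⁻¹) ∂μ)
    (Bset : G → Set G) (hBsetc : ∀ g, IsCompact (Bset g))
    (hcanc : ∀ n, ∀ᵐ g ∂μ, ¬ E g → ∫ x in Ω n, θ (x * g * x⁻¹) ∂μ = ∫ x in Ω n ∩ Bset g, θ (x * g * x⁻¹) ∂μ)
    (W : G → ℝ)
    (hballE : ∀ᵐ g ∂μ, E g → ∫ x in BsetE g, ‖θ (x * g * x⁻¹)‖ ∂μ ≤ W g)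
    (hball : ∀ᵐ g ∂μ, ¬ E g → ∫ x in Bset g, ‖θ (x * g * x⁻¹)‖ ∂μ ≤ W g)
    (hW : LocallyIntegrable W μ) :
    ∃ M : G → ℝ, LocallyIntegrable M μ ∧ ∀ n, ∀ᵐ g ∂μ, ‖∫ x in Ω n, θ (x * g * x⁻¹) ∂μ‖ ≤ M g := by
  refine ⟨W, hW, fun n => ?_⟩
  filter_upwards [hcancE n, hcanc n, hballE, hball] with g h1 h2 h3 h4
  by_cases hg : E g
  · exact (norm_setIntegral_conj_le_of_localisation μ hθ g (hBsetEc g) (h1 hg)).trans (h3 hg)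
  · exact (norm_setIntegral_conj_le_of_localisation μ hθ g (hBsetc g) (h2 hg)).trans (h4 hg)

omit [IsTopologicalGroup G] in
/-- **Localisation is automatic where the orbital integrand has compact support**: if `{x : x g x⁻¹ ∈ tsupport θ}` is compact (`g` regular elliptic, ★ properness),
then `∫_S θ(xgx⁻¹) = ∫_{S ∩ {x : xgx⁻¹ ∈ tsupport θ}} θ(xgx⁻¹)` for EVERY measurable `S` — the (D3′) input on the elliptic set, no Theorem 20 needed.
[cite: HarishChandra1970, Part VII §3 p. 72; Part V §1 Lemma 19] -/
theorem setIntegral_conj_eq_inter_preimage_tsupport (μ : Measure G) (θ : G → ℂ) (g : G) {S : Set G} (hS : MeasurableSet S)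
    (hC : IsCompact {x : G | x * g * x⁻¹ ∈ tsupport θ}) :
    ∫ x in S, θ (x * g * x⁻¹) ∂μ = ∫ x in S ∩ {x : G | x * g * x⁻¹ ∈ tsupport θ}, θ (x * g * x⁻¹) ∂μ := by
  have hCm : MeasurableSet {x : G | x * g * x⁻¹ ∈ tsupport θ} := hC.isClosed.measurableSet
  rw [← integral_indicator hS, ← integral_indicator (hS.inter hCm)]
  refine integral_congr_ae (Eventually.of_forall fun x => ?_)
  by_cases hx : x ∈ S
  · by_cases hx' : x * g * x⁻¹ ∈ tsupport θ
    · rw [Set.indicator_of_mem hx, Set.indicator_of_mem (Set.mem_inter hx hx')]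
    · rw [Set.indicator_of_mem hx, Set.indicator_of_notMem (fun h => hx' h.2), image_eq_zero_of_notMem_tsupport hx']
  · rw [Set.indicator_of_notMem hx, Set.indicator_of_notMem (fun h => hx h.1)]

end Generic

/-! ## §2 At the socket's data: (SC-dom) for the supercuspidal coefficient from (D1)–(D4), elliptic localisation discharged -/

section CM

variable (L : Type) [Field L] [NumberField L] [IsCMField L] (N : ℕ) (H : Matrix (Fin N) (Fin N) L)

open scoped Classical in
/-- **(SC-dom) FROM BRICKS at `G = U_N(H)(L⁺_v)`, `v` non-split** — the 2nd ∧ 3rd conjuncts of the letter `sig_K2E3SupercuspidalTruncatedCharAnalytic` for the datum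
`(r, B, v₁)` and the compact exhaustion `Ω`, from: (D3′) `hcanc` — compact balls `Bset g` localising `∫_{Ω n} θ(xgx⁻¹)` uniformly in `n` OFF the regular elliptic set
[HC Thm 20 + Cor. Thm 18]; (D1–2′) `hball` ∕ (D1e′) `hballE` — the ball resp. full absolute orbital integrals bounded by a weight `W` [HC Thms 14, 18, 19]; (D4′) `hW` —
`W ∈ L¹_loc` [HC Thm 15].  ON the regular elliptic set the localisation is discharged here: the coefficient `θ = B v₁ (r · v₁)` has compact support (compact centre, ★
`IsSupercuspidal.hasCompactSupport_sesqForm_apply_apply`) and `{x : xgx⁻¹ ∈ supp θ}` is compact (★ `isCompact_setOf_conj_mem_cmDatum_local`).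
[cite: HarishChandra1970, Part VII §3 pp. 71–73; Thms 14, 15, 18–20] [cite: Rogawski1990, §12.2 p. 173] -/
theorem truncatedCharDominated_of_bricks (hH : (H.map (cmConjRingHom L))ᵀ = H) (hdet : H.det ≠ 0)
    (v : HeightOneSpectrum (𝓞 ↥(maximalRealSubfield L))) (hns : ∀ w : PlacesOver L v, IsCMField.complexConj L • w.1 = w.1)
    [MeasurableSpace ((UnitaryGroup.cmDatum L N H).Local v)] [BorelSpace ((UnitaryGroup.cmDatum L N H).Local v)]
    (μ : Measure ((UnitaryGroup.cmDatum L N H).Local v)) [μ.IsHaarMeasure]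
    (r : SmoothIrrep ((UnitaryGroup.cmDatum L N H).Local v)) (hsc : r.ρ.IsSupercuspidal)
    (B : r.V →ₗ⋆[ℂ] r.V →ₗ[ℂ] ℂ) (hBinv : ∀ (g : (UnitaryGroup.cmDatum L N H).Local v) (x y : r.V), B (r.ρ g x) (r.ρ g y) = B x y)
    (v₁ : r.V) (Ω : CompactExhaustion ((UnitaryGroup.cmDatum L N H).Local v))
    (Bset : (UnitaryGroup.cmDatum L N H).Local v → Set ((UnitaryGroup.cmDatum L N H).Local v)) (hBsetc : ∀ g, IsCompact (Bset g))
    (hcanc : ∀ n, ∀ᵐ g ∂μ, ¬ (IsRegularElt (g.val : GL (Fin N) (UnitaryGroup.LocalRing L v)) ∧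
        IsCompact ((Subgroup.centralizer ({g} : Set ((UnitaryGroup.cmDatum L N H).Local v))) : Set ((UnitaryGroup.cmDatum L N H).Local v))) →
      ∫ x in Ω n, B v₁ (r.ρ (x * g * x⁻¹) v₁) ∂μ = ∫ x in Ω n ∩ Bset g, B v₁ (r.ρ (x * g * x⁻¹) v₁) ∂μ)
    (W : (UnitaryGroup.cmDatum L N H).Local v → ℝ)
    (hballE : ∀ᵐ g ∂μ, (IsRegularElt (g.val : GL (Fin N) (UnitaryGroup.LocalRing L v)) ∧
        IsCompact ((Subgroup.centralizer ({g} : Set ((UnitaryGroup.cmDatum L N H).Local v))) : Set ((UnitaryGroup.cmDatum L N H).Local v))) →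
      ∫ x, ‖B v₁ (r.ρ (x * g * x⁻¹) v₁)‖ ∂μ ≤ W g)
    (hball : ∀ᵐ g ∂μ, ¬ (IsRegularElt (g.val : GL (Fin N) (UnitaryGroup.LocalRing L v)) ∧
        IsCompact ((Subgroup.centralizer ({g} : Set ((UnitaryGroup.cmDatum L N H).Local v))) : Set ((UnitaryGroup.cmDatum L N H).Local v))) →
      ∫ x in Bset g, ‖B v₁ (r.ρ (x * g * x⁻¹) v₁)‖ ∂μ ≤ W g)
    (hW : LocallyIntegrable W μ) :
    ∃ M : (UnitaryGroup.cmDatum L N H).Local v → ℝ, LocallyIntegrable M μ ∧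
      ∀ n : ℕ, ∀ᵐ g ∂μ, ‖∫ x in Ω n, B v₁ (r.ρ (x * g * x⁻¹) v₁) ∂μ‖ ≤ M g := by
  -- frame: compact centre (non-split `v`), a place over `v`, continuity and compact support of the coefficient
  obtain ⟨-, hZ⟩ := K2E3CharLocIntNearSemisimpleSupercuspidalOfTruncated.exists_compactOpen_and_isCompact_center_of_nonsplit L N H hH hdet v hns
  obtain ⟨w⟩ := (inferInstance : Nonempty (PlacesOver L v))
  have hθ : Continuous fun y : (UnitaryGroup.cmDatum L N H).Local v => B v₁ (r.ρ y v₁) :=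
    Representation.continuous_sesqForm_apply_apply (r.isSmooth v₁) v₁
  have hcpt : HasCompactSupport (fun y : (UnitaryGroup.cmDatum L N H).Local v => B v₁ (r.ρ y v₁)) :=
    hsc.hasCompactSupport_sesqForm_apply_apply hZ r.isSmooth hBinv v₁ v₁
  -- the elliptic ball: `{x : x g x⁻¹ ∈ supp θ}` when `g` is regular elliptic, `∅` otherwise (compact either way)
  set BsetE : (UnitaryGroup.cmDatum L N H).Local v → Set ((UnitaryGroup.cmDatum L N H).Local v) := fun g =>
    if IsRegularElt (g.val : GL (Fin N) (UnitaryGroup.LocalRing L v)) ∧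
        IsCompact ((Subgroup.centralizer ({g} : Set ((UnitaryGroup.cmDatum L N H).Local v))) : Set ((UnitaryGroup.cmDatum L N H).Local v))
      then {x | x * g * x⁻¹ ∈ tsupport (fun y : (UnitaryGroup.cmDatum L N H).Local v => B v₁ (r.ρ y v₁))} else ∅ with hBsetE
  have hBsetE_of : ∀ g, IsRegularElt (g.val : GL (Fin N) (UnitaryGroup.LocalRing L v)) ∧
      IsCompact ((Subgroup.centralizer ({g} : Set ((UnitaryGroup.cmDatum L N H).Local v))) : Set ((UnitaryGroup.cmDatum L N H).Local v)) →
      BsetE g = {x | x * g * x⁻¹ ∈ tsupport (fun y : (UnitaryGroup.cmDatum L N H).Local v => B v₁ (r.ρ y v₁))} := fun g hg => by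
    rw [hBsetE]; exact if_pos hg
  have hCpt : ∀ g, IsRegularElt (g.val : GL (Fin N) (UnitaryGroup.LocalRing L v)) ∧
      IsCompact ((Subgroup.centralizer ({g} : Set ((UnitaryGroup.cmDatum L N H).Local v))) : Set ((UnitaryGroup.cmDatum L N H).Local v)) →
      IsCompact {x : (UnitaryGroup.cmDatum L N H).Local v | x * g * x⁻¹ ∈ tsupport (fun y : (UnitaryGroup.cmDatum L N H).Local v => B v₁ (r.ρ y v₁))} :=
    fun g hg => K2E3TruncatedOrbitalIntegralEventuallyEq.isCompact_setOf_conj_mem_cmDatum_local L N H hH (isUnit_iff_ne_zero.2 hdet) w (hns w) g hg.1 hg.2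
      hcpt.isCompact
  have hBsetEc : ∀ g, IsCompact (BsetE g) := fun g => by
    by_cases hg : IsRegularElt (g.val : GL (Fin N) (UnitaryGroup.LocalRing L v)) ∧
        IsCompact ((Subgroup.centralizer ({g} : Set ((UnitaryGroup.cmDatum L N H).Local v))) : Set ((UnitaryGroup.cmDatum L N H).Local v))
    · rw [hBsetE_of g hg]; exact hCpt g hg
    · have h0 : BsetE g = ∅ := by rw [hBsetE]; exact if_neg hg
      rw [h0]; exact isCompact_empty
  have hcancE : ∀ n, ∀ᵐ g ∂μ, (IsRegularElt (g.val : GL (Fin N) (UnitaryGroup.LocalRing L v)) ∧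
      IsCompact ((Subgroup.centralizer ({g} : Set ((UnitaryGroup.cmDatum L N H).Local v))) : Set ((UnitaryGroup.cmDatum L N H).Local v))) →
      ∫ x in Ω n, B v₁ (r.ρ (x * g * x⁻¹) v₁) ∂μ = ∫ x in Ω n ∩ BsetE g, B v₁ (r.ρ (x * g * x⁻¹) v₁) ∂μ := fun n =>
    Eventually.of_forall fun g hg => by
      rw [hBsetE_of g hg]
      exact setIntegral_conj_eq_inter_preimage_tsupport μ (fun y : (UnitaryGroup.cmDatum L N H).Local v => B v₁ (r.ρ y v₁)) g
        (Ω.isCompact n).isClosed.measurableSet (hCpt g hg)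
  -- the ball bound on the elliptic set: the full absolute orbital integral dominates the ball integral
  have hballE' : ∀ᵐ g ∂μ, (IsRegularElt (g.val : GL (Fin N) (UnitaryGroup.LocalRing L v)) ∧
      IsCompact ((Subgroup.centralizer ({g} : Set ((UnitaryGroup.cmDatum L N H).Local v))) : Set ((UnitaryGroup.cmDatum L N H).Local v))) →
      ∫ x in BsetE g, ‖B v₁ (r.ρ (x * g * x⁻¹) v₁)‖ ∂μ ≤ W g := by
    filter_upwards [hballE] with g hg hE
    refine le_trans ?_ (hg hE)
    -- `∫_{BsetE g} ‖θ(xgx⁻¹)‖ ≤ ∫_G ‖θ(xgx⁻¹)‖`: the integrand is integrable on `G` (continuous, compactly supported in `x` by properness)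
    have hcont : Continuous fun x : (UnitaryGroup.cmDatum L N H).Local v => ‖B v₁ (r.ρ (x * g * x⁻¹) v₁)‖ :=
      (hθ.comp ((continuous_id.mul continuous_const).mul continuous_inv)).norm
    have hsupp : HasCompactSupport fun x : (UnitaryGroup.cmDatum L N H).Local v => ‖B v₁ (r.ρ (x * g * x⁻¹) v₁)‖ := by
      refine HasCompactSupport.of_support_subset_isCompact (hCpt g hE) fun x hx => ?_
      by_contra hx'
      rw [Set.mem_setOf_eq] at hx'
      exact hx (show ‖B v₁ (r.ρ (x * g * x⁻¹) v₁)‖ = 0 by rw [image_eq_zero_of_notMem_tsupport hx', norm_zero])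
    have hint : Integrable (fun x : (UnitaryGroup.cmDatum L N H).Local v => ‖B v₁ (r.ρ (x * g * x⁻¹) v₁)‖) μ := hcont.integrable_of_hasCompactSupport hsupp
    calc ∫ x in BsetE g, ‖B v₁ (r.ρ (x * g * x⁻¹) v₁)‖ ∂μ ≤ ∫ x in Set.univ, ‖B v₁ (r.ρ (x * g * x⁻¹) v₁)‖ ∂μ :=
          setIntegral_mono_set hint.integrableOn (Eventually.of_forall fun x => norm_nonneg _) (Eventually.of_forall (Set.subset_univ _))
      _ = ∫ x, ‖B v₁ (r.ρ (x * g * x⁻¹) v₁)‖ ∂μ := by rw [Measure.restrict_univ]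
  exact truncated_dominated_of_bricks μ hθ Ω
    (fun g => IsRegularElt (g.val : GL (Fin N) (UnitaryGroup.LocalRing L v)) ∧
      IsCompact ((Subgroup.centralizer ({g} : Set ((UnitaryGroup.cmDatum L N H).Local v))) : Set ((UnitaryGroup.cmDatum L N H).Local v)))
    BsetE hBsetEc hcancE Bset hBsetc hcanc W hballE' hball hW

/-! ## §3 Both halves together: the (SC-an) ∃-statement for the datum from the limit brick and the domination bricks -/

open scoped Classical in
/-- **(SC-an) FOR ONE DATUM, FROM BRICKS** — EXACTLY the consequent of `sig_K2E3SupercuspidalTruncatedCharAnalytic` for `(r, B, v₁, μ)`: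
`∃ Ω F M, (SC-lim∖ell) ∧ (SC-dom) ∧ M ∈ L¹_loc`, from ONE compact exhaustion `Ω` carrying (a) the limit brick `hlim` (convergence off the regular elliptic set — HC Thm 20
+ eq. (2) p. 72) and (b) the domination bricks (D3′)(D1–2′)(D1e′)(D4′) of `truncatedCharDominated_of_bricks`.  The docking point of the whole (SC-an) letter.
[cite: HarishChandra1970, Part VII §3 pp. 70–73] -/
theorem sigSCan_datum_of_bricks (hH : (H.map (cmConjRingHom L))ᵀ = H) (hdet : H.det ≠ 0)
    (v : HeightOneSpectrum (𝓞 ↥(maximalRealSubfield L))) (hns : ∀ w : PlacesOver L v, IsCMField.complexConj L • w.1 = w.1)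
    [MeasurableSpace ((UnitaryGroup.cmDatum L N H).Local v)] [BorelSpace ((UnitaryGroup.cmDatum L N H).Local v)]
    (μ : Measure ((UnitaryGroup.cmDatum L N H).Local v)) [μ.IsHaarMeasure]
    (r : SmoothIrrep ((UnitaryGroup.cmDatum L N H).Local v)) (hsc : r.ρ.IsSupercuspidal)
    (B : r.V →ₗ⋆[ℂ] r.V →ₗ[ℂ] ℂ) (hBinv : ∀ (g : (UnitaryGroup.cmDatum L N H).Local v) (x y : r.V), B (r.ρ g x) (r.ρ g y) = B x y)
    (v₁ : r.V) (Ω : CompactExhaustion ((UnitaryGroup.cmDatum L N H).Local v))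
    (F : (UnitaryGroup.cmDatum L N H).Local v → ℂ)
    (hlim : ∀ᵐ g ∂μ, ¬ (IsRegularElt (g.val : GL (Fin N) (UnitaryGroup.LocalRing L v)) ∧
        IsCompact ((Subgroup.centralizer ({g} : Set ((UnitaryGroup.cmDatum L N H).Local v))) : Set ((UnitaryGroup.cmDatum L N H).Local v))) →
      Tendsto (fun n => ∫ x in Ω n, B v₁ (r.ρ (x * g * x⁻¹) v₁) ∂μ) atTop (𝓝 (F g)))
    (Bset : (UnitaryGroup.cmDatum L N H).Local v → Set ((UnitaryGroup.cmDatum L N H).Local v)) (hBsetc : ∀ g, IsCompact (Bset g))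
    (hcanc : ∀ n, ∀ᵐ g ∂μ, ¬ (IsRegularElt (g.val : GL (Fin N) (UnitaryGroup.LocalRing L v)) ∧
        IsCompact ((Subgroup.centralizer ({g} : Set ((UnitaryGroup.cmDatum L N H).Local v))) : Set ((UnitaryGroup.cmDatum L N H).Local v))) →
      ∫ x in Ω n, B v₁ (r.ρ (x * g * x⁻¹) v₁) ∂μ = ∫ x in Ω n ∩ Bset g, B v₁ (r.ρ (x * g * x⁻¹) v₁) ∂μ)
    (W : (UnitaryGroup.cmDatum L N H).Local v → ℝ)
    (hballE : ∀ᵐ g ∂μ, (IsRegularElt (g.val : GL (Fin N) (UnitaryGroup.LocalRing L v)) ∧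
        IsCompact ((Subgroup.centralizer ({g} : Set ((UnitaryGroup.cmDatum L N H).Local v))) : Set ((UnitaryGroup.cmDatum L N H).Local v))) →
      ∫ x, ‖B v₁ (r.ρ (x * g * x⁻¹) v₁)‖ ∂μ ≤ W g)
    (hball : ∀ᵐ g ∂μ, ¬ (IsRegularElt (g.val : GL (Fin N) (UnitaryGroup.LocalRing L v)) ∧
        IsCompact ((Subgroup.centralizer ({g} : Set ((UnitaryGroup.cmDatum L N H).Local v))) : Set ((UnitaryGroup.cmDatum L N H).Local v))) →
      ∫ x in Bset g, ‖B v₁ (r.ρ (x * g * x⁻¹) v₁)‖ ∂μ ≤ W g)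
    (hW : LocallyIntegrable W μ) :
    ∃ (Ω' : CompactExhaustion ((UnitaryGroup.cmDatum L N H).Local v))
      (F' : (UnitaryGroup.cmDatum L N H).Local v → ℂ) (M : (UnitaryGroup.cmDatum L N H).Local v → ℝ),
      (∀ᵐ g ∂μ, ¬ (IsRegularElt (g.val : GL (Fin N) (UnitaryGroup.LocalRing L v)) ∧
          IsCompact ((Subgroup.centralizer ({g} : Set ((UnitaryGroup.cmDatum L N H).Local v))) : Set ((UnitaryGroup.cmDatum L N H).Local v))) →
        Tendsto (fun n => ∫ x in Ω' n, B v₁ (r.ρ (x * g * x⁻¹) v₁) ∂μ) atTop (𝓝 (F' g))) ∧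
      (∀ n : ℕ, ∀ᵐ g ∂μ, ‖∫ x in Ω' n, B v₁ (r.ρ (x * g * x⁻¹) v₁) ∂μ‖ ≤ M g) ∧
      LocallyIntegrable M μ := by
  obtain ⟨M, hM, hdom⟩ := truncatedCharDominated_of_bricks L N H hH hdet v hns μ r hsc B hBinv v₁ Ω Bset hBsetc hcanc W hballE hball hW
  exact ⟨Ω, F, M, hlim, hdom, hM⟩

end CM

end Summit.HodgeConjecture.HodgeConjecture.Cruxes.H413.K2E3SupercuspidalTruncatedCharDominationOfBricks

end
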